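import Literature.Analysis.FluidPDE.HolderFieldCalculus
import Literature.Analysis.FluidPDE.HolderLeibnizBounds
import Literature.Analysis.FluidPDE.ForcedHeatDuhamelTime
import Literature.Analysis.UnboundedOperators.HeatDuhamelSliceLevel
import HarnessLib

/-!
# Tools for semilinear heat equations: Hölder gain of the Duhamel gradient on bounded data,
# Hölder fields under smooth nonlinear maps, and the Laplacian of iterated derivatives

Analysis/PDE support file (everything proved; no definitions, no named facts). It supplies the
three calculus inputs of the local well-posedness theory of semilinear heat systems
`∂ₜu = Δu + f(x, u, ∂u)` with smooth bounded data on the whole space (Taylor, *PDE III*, Ch. 15,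
§1, Prop. 1.1; Lunardi, *Analytic semigroups and optimal regularity in parabolic problems*,
Thm. 7.1.2 and Prop. 7.1.10), in the elementary heat-semigroup form of the tree
(`UnboundedOperators.heatExtension`, the slice Duhamel integral `∫₀ᵗ e^{(t−s)Δ}g(s) ds` of
`HeatDuhamelSliceRegularity.lean`, the one-constant Hölder classes `IsHolderField k α A` of
`OseenSliceHolder.lean`):

* `norm_fderiv_duhamel_sub_le_of_bound` — **the gradient of the Duhamel integral of bounded
  measurable data is `1/2`-Hölder in space**, `‖DJ[g](t,x) − DJ[g](t,x')‖ ≤ 8c²C t^{1/4}‖x − x'‖^{1/2}`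
  (`c = 2^{d/2}`; the slice `D e^{σΔ}g(s)` is bounded by `cσ^{-1/2}C` and `2c²σ^{-1}C`-Lipschitz,
  and `min(2B, Lr) ≤ √(2BLr)` leaves the integrable weight `σ^{-3/4}`). This starts the Hölder
  bootstrap of a mild solution which is only `C¹` in space.
* `exists_holder_comp` — **a smooth function of a `C^{n,γ}` field is `C^{n,γ}`**: for
  `Φ : E × W → V'` of class `C^{n+1}` with `‖DʲΦ(x, a)‖ ≤ B` (`j ≤ n + 1`, `‖a‖ ≤ A`) and
  `w ∈ C^{n,γ}` with constant `A`, the field `x ↦ Φ(x, w(x))` is `C^{n,γ}` with constant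
  `K(n)((1 + A)(1 + B))^{2ⁿ}` (induction on `n` through `D(Φ ∘ graph w) = ∂₁Φ ∘ graph w +
  (∂₂Φ ∘ graph w) ∘ Dw`, the Leibniz–Hölder bounds `HolderLeibniz.exists_leibniz_holder` and
  `IsHolderField.of_fderiv_right`). This is the step "`f(x, u, ∂u) ∈ C^{n,γ}` if
  `u ∈ C^{n+1,γ}`" of the bootstrap.
* `fderiv_laplacian`, `iteratedFDeriv_laplacian` — `D^k(Δf) = Δ(D^k f)` for `f ∈ C^{k+2}`
  (Schwarz), used to identify `∂ₜD^k u = Δ D^k u + D^k g` with `D^k(Δu + g)`.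

## References

* M. E. Taylor, *Partial Differential Equations III. Nonlinear Equations*, 2nd ed., Springer
  (2011), Ch. 15, §1 (semilinear parabolic equations; Prop. 1.1 and the regularity remarks
  following it). [TaylorPDEIII2011]
* A. Lunardi, *Analytic Semigroups and Optimal Regularity in Parabolic Problems*, Birkhäuser
  (1995), §7.1 (local existence and regularity for fully nonlinear/semilinear parabolic problems
  in Hölder classes). [folklore]
* Y. Giga, M.-H. Giga, J. Saal, *Nonlinear PDEs* (2010), §1.1.3 (derivative estimates for the
  heat semigroup). [GigaGigaSaal2010]
-/

noncomputable section

open MeasureTheory Set Function Filter Metric Real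
open _root_.Topology
open scoped ENNReal NNReal ContDiff Laplacian

namespace Literature.Analysis.PDE

namespace SemilinearHeat

open Literature.Analysis.UnboundedOperators Literature.Analysis.UnboundedOperators.HeatHolder
open Literature.Analysis.FluidPDE


/-! ### The gradient of the Duhamel integral of bounded data is `1/2`-Hölder -/

section DuhamelHolder

-- nested operator types `E →L[ℝ] E →L[ℝ] F`
set_option maxSynthPendingDepth 3

variable {E : Type*} [NormedAddCommGroup E] [InnerProductSpace ℝ E] [FiniteDimensional ℝ E]
  [MeasurableSpace E] [BorelSpace E]
variable {F : Type*} [NormedAddCommGroup F] [NormedSpace ℝ F] [CompleteSpace F]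

/-- **Second derivatives of the heat extension of bounded data**:
`‖D²(e^{σΔ}h)(y)‖ ≤ 2c²σ⁻¹C` for continuous `h` with `‖h‖ ≤ C` (`c = 2^{d/2}`; semigroup law at
`σ/2 + σ/2`, the derivative falls on the `C¹` slice `e^{(σ/2)Δ}h`, and the gradient bound twice).
[cite: GigaGigaSaal2010, §1.1.3] -/
theorem norm_fderiv_fderiv_heatExtension_le_of_bound {h : E → F} (hh : Continuous h) {C : ℝ}
    (hC : ∀ z, ‖h z‖ ≤ C) {σ : ℝ} (hσ : 0 < σ) (y : E) :
    ‖fderiv ℝ (fderiv ℝ (heatExtension h σ)) y‖ ≤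
      2 * ((2 : ℝ) ^ ((Module.finrank ℝ E : ℝ) / 2)) ^ 2 * σ⁻¹ * C := by
  set c : ℝ := (2 : ℝ) ^ ((Module.finrank ℝ E : ℝ) / 2) with hc
  have hσ2 : 0 < σ / 2 := half_pos hσ
  set k : E → F := heatExtension h (σ / 2) with hk
  have hkc : ContDiff ℝ 1 k := contDiff_heatExtension_of_bound hh hC hσ2
  have hk0 : ∀ z, ‖k z‖ ≤ C := fun z => norm_heatExtension_le_of_bound hC hσ2 z
  have hk1 : ∀ z, ‖fderiv ℝ k z‖ ≤ c * (σ / 2) ^ (-(1 / 2 : ℝ)) * C := fun z =>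
    norm_fderiv_heatExtension_le_of_bounded hh.aestronglyMeasurable hC hσ2 z
  have hsemi : heatExtension h σ = heatExtension k (σ / 2) :=
    heatExtension_eq_heatExtension_half hh hC hσ
  have hD : fderiv ℝ (heatExtension k (σ / 2)) = fun z => heatExtension (fderiv ℝ k) (σ / 2) z :=
    funext fun z => fderiv_heatExtension_of_bounded hkc hk0 hk1 hσ2 z
  have hmeas : AEStronglyMeasurable (fderiv ℝ k) volume :=
    (hkc.continuous_fderiv one_ne_zero).aestronglyMeasurable
  rw [hsemi, hD]
  have hpow : (σ / 2) ^ (-(1 / 2 : ℝ)) * (σ / 2) ^ (-(1 / 2 : ℝ)) = (σ / 2)⁻¹ := by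
    rw [← Real.rpow_add hσ2, show (-(1 / 2 : ℝ)) + -(1 / 2 : ℝ) = -1 by norm_num, Real.rpow_neg_one]
  calc ‖fderiv ℝ (fun z => heatExtension (fderiv ℝ k) (σ / 2) z) y‖
      = ‖fderiv ℝ (heatExtension (fderiv ℝ k) (σ / 2)) y‖ := rfl
    _ ≤ c * (σ / 2) ^ (-(1 / 2 : ℝ)) * (c * (σ / 2) ^ (-(1 / 2 : ℝ)) * C) :=
        norm_fderiv_heatExtension_le_of_bounded hmeas hk1 hσ2 y
    _ = c ^ 2 * ((σ / 2) ^ (-(1 / 2 : ℝ)) * (σ / 2) ^ (-(1 / 2 : ℝ))) * C := by ring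
    _ = 2 * c ^ 2 * σ⁻¹ * C := by rw [hpow]; field_simp

/-- **The gradient of the Duhamel integral of bounded data is `1/2`-Hölder in space.** For a
strongly measurable family `g` of continuous slices bounded by `C` and `0 < t`,
`‖DJ[g](t, x) − DJ[g](t, x')‖ ≤ 8c² C t^{1/4} ‖x − x'‖^{1/2}`, `J[g](t) = ∫₀ᵗ e^{(t−s)Δ}g(s) ds`:
the integrand `D e^{(t−s)Δ}g(s)` is bounded by `c(t−s)^{-1/2}C` and `2c²(t−s)^{-1}C`-Lipschitz, so
its increment is at most `min(2c(t−s)^{-1/2}C, 2c²(t−s)^{-1}C‖x − x'‖) ≤ 2c²C(t−s)^{-3/4}‖x − x'‖^{1/2}`,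
and `∫₀ᵗ (t−s)^{-3/4} ds = 4t^{1/4}`. [cite: GigaGigaSaal2010, §1.1.3] -/
theorem norm_fderiv_duhamel_sub_le_of_bound {g : ℝ → E → F} {C : ℝ}
    (hgm : StronglyMeasurable (uncurry g)) (hgc : ∀ s, Continuous (g s))
    (hgC : ∀ s y, ‖g s y‖ ≤ C) {t : ℝ} (ht : 0 < t) (x x' : E) :
    ‖fderiv ℝ (fun x => ∫ s in Ioo 0 t, heatExtension (g s) (t - s) x) x -
        fderiv ℝ (fun x => ∫ s in Ioo 0 t, heatExtension (g s) (t - s) x) x'‖ ≤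
      8 * ((2 : ℝ) ^ ((Module.finrank ℝ E : ℝ) / 2)) ^ 2 * C * t ^ (1 / 4 : ℝ) *
        ‖x - x'‖ ^ (1 / 2 : ℝ) := by
  set c : ℝ := (2 : ℝ) ^ ((Module.finrank ℝ E : ℝ) / 2) with hc
  have hc1 : 1 ≤ c := Real.one_le_rpow (by norm_num) (by positivity)
  have hC0 : 0 ≤ C := (norm_nonneg _).trans (hgC 0 0)
  rw [(hasFDerivAt_duhamel hgm hgc hgC t x).fderiv, (hasFDerivAt_duhamel hgm hgc hgC t x').fderiv]
  set r : ℝ := ‖x - x'‖ with hr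
  have hr0 : 0 ≤ r := norm_nonneg _
  -- integrability of the derivative lifts at both points
  have hint : ∀ z, IntegrableOn (fun s => fderiv ℝ (heatExtension (g s) (t - s)) z) (Ioo 0 t) volume := by
    intro z
    have hb : IntegrableOn (fun s : ℝ => c * (t - s) ^ (-(1 / 2 : ℝ)) * C) (Ioo 0 t) volume :=
      ((integrableOn_rpow_sub (r := -(1 / 2 : ℝ)) (by norm_num) 0 t).const_mul c).mul_const C
    refine hb.mono' (aestronglyMeasurable_fderiv_lift_apply hgm hgc hgC t z) ?_
    filter_upwards [ae_restrict_mem measurableSet_Ioo] with s hs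
    exact norm_fderiv_heatExtension_le_of_bounded (hgc s).aestronglyMeasurable (hgC s)
      (sub_pos.2 hs.2) z
  rw [← integral_sub (hint x) (hint x')]
  -- pointwise bound of the increment of the integrand
  have hpt : ∀ s ∈ Ioo (0 : ℝ) t,
      ‖fderiv ℝ (heatExtension (g s) (t - s)) x - fderiv ℝ (heatExtension (g s) (t - s)) x'‖ ≤
        2 * c ^ 2 * C * (t - s) ^ (-(3 / 4 : ℝ)) * Real.sqrt r := by
    intro s hs
    have hσ : 0 < t - s := sub_pos.2 hs.2
    -- the two bounds
    have hB : ∀ z, ‖fderiv ℝ (heatExtension (g s) (t - s)) z‖ ≤ c * (t - s) ^ (-(1 / 2 : ℝ)) * C :=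
      fun z => norm_fderiv_heatExtension_le_of_bounded (hgc s).aestronglyMeasurable (hgC s) hσ z
    have h1 : ‖fderiv ℝ (heatExtension (g s) (t - s)) x - fderiv ℝ (heatExtension (g s) (t - s)) x'‖ ≤
        2 * (c * (t - s) ^ (-(1 / 2 : ℝ)) * C) :=
      (norm_sub_le _ _).trans (by linarith [hB x, hB x'])
    have hL : ∀ z, ‖fderiv ℝ (fderiv ℝ (heatExtension (g s) (t - s))) z‖ ≤ 2 * c ^ 2 * (t - s)⁻¹ * C :=
      fun z => norm_fderiv_fderiv_heatExtension_le_of_bound (hgc s) (hgC s) hσ z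
    have hdiff : Differentiable ℝ (fderiv ℝ (heatExtension (g s) (t - s))) :=
      ((contDiff_heatExtension_of_bound (hgc s) (hgC s) hσ (m := 2)).fderiv_right (m := 1)
        (by norm_cast)).differentiable one_ne_zero
    have h2 : ‖fderiv ℝ (heatExtension (g s) (t - s)) x - fderiv ℝ (heatExtension (g s) (t - s)) x'‖ ≤
        2 * c ^ 2 * (t - s)⁻¹ * C * r :=
      Convex.norm_image_sub_le_of_norm_fderiv_le (fun z _ => hdiff z) (fun z _ => hL z) convex_univ
        (mem_univ x') (mem_univ x)
    have hle := le_min h1 h2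
    have hmin := min_le_sqrt_mul (x := 2 * (c * (t - s) ^ (-(1 / 2 : ℝ)) * C))
      (y := 2 * c ^ 2 * (t - s)⁻¹ * C * r) (by positivity) (by positivity)
    have hσpow : (t - s) ^ (-(1 / 2 : ℝ)) * (t - s)⁻¹ = ((t - s) ^ (-(3 / 4 : ℝ))) ^ 2 := by
      rw [← Real.rpow_natCast, ← Real.rpow_mul hσ.le, ← Real.rpow_neg_one (t - s),
        ← Real.rpow_add hσ]
      norm_num
    have hprod : 2 * (c * (t - s) ^ (-(1 / 2 : ℝ)) * C) * (2 * c ^ 2 * (t - s)⁻¹ * C * r) ≤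
        (2 * c ^ 2 * C * (t - s) ^ (-(3 / 4 : ℝ))) ^ 2 * r := by
      have hc34 : c ^ 3 ≤ c ^ 4 := pow_le_pow_right₀ hc1 (by norm_num)
      have hw : 0 ≤ (t - s) ^ (-(1 / 2 : ℝ)) * (t - s)⁻¹ := by positivity
      calc 2 * (c * (t - s) ^ (-(1 / 2 : ℝ)) * C) * (2 * c ^ 2 * (t - s)⁻¹ * C * r)
          = 4 * c ^ 3 * (C ^ 2 * ((t - s) ^ (-(1 / 2 : ℝ)) * (t - s)⁻¹) * r) := by ring
        _ ≤ 4 * c ^ 4 * (C ^ 2 * ((t - s) ^ (-(1 / 2 : ℝ)) * (t - s)⁻¹) * r) := by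
            gcongr
        _ = (2 * c ^ 2 * C * (t - s) ^ (-(3 / 4 : ℝ))) ^ 2 * r := by rw [hσpow]; ring
    calc ‖fderiv ℝ (heatExtension (g s) (t - s)) x - fderiv ℝ (heatExtension (g s) (t - s)) x'‖
        ≤ Real.sqrt (2 * (c * (t - s) ^ (-(1 / 2 : ℝ)) * C) * (2 * c ^ 2 * (t - s)⁻¹ * C * r)) :=
          hle.trans hmin
      _ ≤ Real.sqrt ((2 * c ^ 2 * C * (t - s) ^ (-(3 / 4 : ℝ))) ^ 2 * r) := Real.sqrt_le_sqrt hprod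
      _ = 2 * c ^ 2 * C * (t - s) ^ (-(3 / 4 : ℝ)) * Real.sqrt r := by
          rw [Real.sqrt_mul (sq_nonneg _), Real.sqrt_sq (by positivity)]
  -- integrate the bound
  have hbint : IntegrableOn (fun s : ℝ => 2 * c ^ 2 * C * (t - s) ^ (-(3 / 4 : ℝ)) * Real.sqrt r)
      (Ioo 0 t) volume :=
    ((integrableOn_rpow_sub (r := -(3 / 4 : ℝ)) (by norm_num) 0 t).const_mul (2 * c ^ 2 * C)).mul_const
      (Real.sqrt r)
  calc ‖∫ s in Ioo 0 t, (fderiv ℝ (heatExtension (g s) (t - s)) x - fderiv ℝ (heatExtension (g s) (t - s)) x')‖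
      ≤ ∫ s in Ioo 0 t, 2 * c ^ 2 * C * (t - s) ^ (-(3 / 4 : ℝ)) * Real.sqrt r := by
        refine norm_integral_le_of_norm_le hbint ?_
        filter_upwards [ae_restrict_mem measurableSet_Ioo] with s hs
        exact hpt s hs
    _ = 2 * c ^ 2 * C * Real.sqrt r * ∫ s in Ioo 0 t, (t - s) ^ (-(3 / 4 : ℝ)) := by
        rw [← integral_const_mul]
        exact integral_congr_ae (Eventually.of_forall fun s => by ring)
    _ = 2 * c ^ 2 * C * Real.sqrt r * (t ^ (1 / 4 : ℝ) / (1 / 4)) := by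
        rw [setIntegral_rpow_sub (by norm_num) ht.le, sub_zero]
        norm_num
    _ = 8 * c ^ 2 * C * t ^ (1 / 4 : ℝ) * ‖x - x'‖ ^ (1 / 2 : ℝ) := by
        rw [hr, Real.sqrt_eq_rpow]; ring

/-- **The Duhamel integral of bounded data is a `C^{1,1/2}` field**, with constant
`8c²C t^{1/4}` for `0 < t ≤ 1` (`‖J‖ ≤ Ct`, `‖DJ‖ ≤ 2cC√t`, and the Hölder bound of the
gradient). [cite: GigaGigaSaal2010, §1.1.3] -/
theorem isHolderField_one_duhamel_of_bound {g : ℝ → E → F} {C : ℝ}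
    (hgm : StronglyMeasurable (uncurry g)) (hgc : ∀ s, Continuous (g s))
    (hgC : ∀ s y, ‖g s y‖ ≤ C) {t : ℝ} (ht : 0 < t) (ht1 : t ≤ 1) :
    IsHolderField 1 (1 / 2) (8 * ((2 : ℝ) ^ ((Module.finrank ℝ E : ℝ) / 2)) ^ 2 * C * t ^ (1 / 4 : ℝ))
      (fun x => ∫ s in Ioo 0 t, heatExtension (g s) (t - s) x) := by
  set c : ℝ := (2 : ℝ) ^ ((Module.finrank ℝ E : ℝ) / 2) with hc
  have hc1 : 1 ≤ c := Real.one_le_rpow (by norm_num) (by positivity)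
  have hC0 : 0 ≤ C := (norm_nonneg _).trans (hgC 0 0)
  set A : ℝ := 8 * c ^ 2 * C * t ^ (1 / 4 : ℝ) with hA
  have hA0 : 0 ≤ A := by positivity
  -- comparison of the small factors for `t ≤ 1`
  have ht14 : t ≤ t ^ (1 / 4 : ℝ) := by
    calc t = t ^ (1 : ℝ) := (Real.rpow_one t).symm
      _ ≤ t ^ (1 / 4 : ℝ) := Real.rpow_le_rpow_of_exponent_ge ht ht1 (by norm_num)
  have ht24 : t ^ (1 / 2 : ℝ) ≤ t ^ (1 / 4 : ℝ) :=
    Real.rpow_le_rpow_of_exponent_ge ht ht1 (by norm_num)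
  set J : E → F := fun x => ∫ s in Ioo 0 t, heatExtension (g s) (t - s) x with hJ
  have hJd : Differentiable ℝ J := fun x => (hasFDerivAt_duhamel hgm hgc hgC t x).differentiableAt
  have hJ0 : ∀ x, ‖J x‖ ≤ A := fun x => by
    calc ‖J x‖ ≤ C * t := norm_duhamel_le hgC ht.le x
      _ ≤ C * t ^ (1 / 4 : ℝ) := by gcongr
      _ ≤ A := by
          rw [hA]
          have : C * t ^ (1 / 4 : ℝ) = 1 * (C * t ^ (1 / 4 : ℝ)) := by ring
          rw [this, show 8 * c ^ 2 * C * t ^ (1 / 4 : ℝ) = (8 * c ^ 2) * (C * t ^ (1 / 4 : ℝ)) by ring]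
          exact mul_le_mul_of_nonneg_right (by nlinarith) (by positivity)
  have hJ1 : ∀ x, ‖fderiv ℝ J x‖ ≤ A := fun x => by
    calc ‖fderiv ℝ J x‖ ≤ 2 * c * C * t ^ (1 / 2 : ℝ) := norm_fderiv_duhamel_le hgm hgc hgC ht x
      _ ≤ 2 * c * C * t ^ (1 / 4 : ℝ) := by gcongr
      _ ≤ A := by
          rw [hA]
          have h8 : 2 * c ≤ 8 * c ^ 2 := by nlinarith
          exact mul_le_mul_of_nonneg_right (mul_le_mul_of_nonneg_right h8 hC0) (by positivity)
  have hH : ∀ x y, ‖fderiv ℝ J x - fderiv ℝ J y‖ ≤ A * ‖x - y‖ ^ (1 / 2 : ℝ) := fun x y =>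
    norm_fderiv_duhamel_sub_le_of_bound hgm hgc hgC ht x y
  have hD : IsHolderField 0 (1 / 2) A (fderiv ℝ J) := by
    refine ⟨contDiff_zero.2 (continuous_of_norm_sub_le_rpow hA0 (by norm_num) hH), ?_, ?_⟩
    · intro j hj x
      obtain rfl : j = 0 := Nat.le_zero.1 hj
      rw [norm_iteratedFDeriv_zero]
      exact hJ1 x
    · intro x y
      rw [iteratedFDeriv_zero_eq_comp, Function.comp_apply, Function.comp_apply, ← map_sub,
        LinearIsometryEquiv.norm_map]
      exact hH x y
  exact IsHolderField.of_fderiv_right hJd hD hJ0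

end DuhamelHolder

/-! ### Smooth functions of Hölder fields -/

section HolderComp

-- nested operator types
set_option maxSynthPendingDepth 3

variable {E : Type} [NormedAddCommGroup E] [NormedSpace ℝ E]

/-- **Pairs of `C^{k,α}` fields are `C^{k,α}`** (`(a, b) = inl ∘ a + inr ∘ b`; constants add).
[folklore] -/
theorem isHolderField_prodMk {F₁ F₂ : Type*} [NormedAddCommGroup F₁] [NormedSpace ℝ F₁]
    [NormedAddCommGroup F₂] [NormedSpace ℝ F₂] {k : ℕ} {α A B : ℝ} {a : E → F₁} {b : E → F₂}
    (ha : IsHolderField k α A a) (hb : IsHolderField k α B b) :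
    IsHolderField k α (A + B) (fun x => (a x, b x)) := by
  have h1 := ha.clm_comp_left (ContinuousLinearMap.inl ℝ F₁ F₂)
  have h2 := hb.clm_comp_left (ContinuousLinearMap.inr ℝ F₁ F₂)
  have h1' : IsHolderField k α A fun x => ContinuousLinearMap.inl ℝ F₁ F₂ (a x) :=
    h1.mono_const (by
      calc ‖ContinuousLinearMap.inl ℝ F₁ F₂‖ * A ≤ 1 * A :=
            mul_le_mul_of_nonneg_right (ContinuousLinearMap.norm_inl_le_one ℝ F₁ F₂) ha.nonneg
        _ = A := one_mul A)
  have h2' : IsHolderField k α B fun x => ContinuousLinearMap.inr ℝ F₁ F₂ (b x) :=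
    h2.mono_const (by
      calc ‖ContinuousLinearMap.inr ℝ F₁ F₂‖ * B ≤ 1 * B :=
            mul_le_mul_of_nonneg_right (ContinuousLinearMap.norm_inr_le_one ℝ F₁ F₂) hb.nonneg
        _ = B := one_mul B)
  have h := h1'.add h2'
  have hfun : ((fun x => ContinuousLinearMap.inl ℝ F₁ F₂ (a x)) + fun x =>
      ContinuousLinearMap.inr ℝ F₁ F₂ (b x)) = fun x => (a x, b x) := by
    funext x
    simp
  rwa [hfun] at h

/-- **A smooth function of a `C^{n,γ}` field is `C^{n,γ}`, with a constant uniform in the field.**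
For every `n` and `0 < γ ≤ 1` there is `K = K(n) ≥ 1` such that: for all real normed spaces `W`,
all Banach spaces `V'`, every `Φ : E × W → V'` of class `C^{n+1}` whose derivatives of order
`≤ n + 1` are bounded by `B` on `E × {‖a‖ ≤ R}`, and every `w : E → W` with `‖w‖ ≤ R` in `C^{n,γ}`
with constant `A`, the composite `x ↦ Φ(x, w(x))` is `C^{n,γ}` with constant `K((1 + A)(1 + B))^{2ⁿ}`.
Induction on `n`: at order zero the mean value inequality on the convex set `E × B̄(0, R)`; the
step differentiates, `D(Φ ∘ graph w) = (∂₁Φ) ∘ graph w + ((∂₂Φ) ∘ graph w) ∘ Dw`, applies the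
induction hypothesis to the partial derivatives `∂ᵢΦ` (again `C^{n+1}` with the same bounds, one
order higher) and the field `w ∈ C^{n,γ}` (constant `2A`, `IsHolderField.of_succ`), the
Leibniz–Hölder bounds to the composition product, and reassembles with
`IsHolderField.of_fderiv_right`. (Gilbarg–Trudinger, *Elliptic PDE of second order*, §4.1; the
composition estimate is the standard one behind "`f(x, u, ∇u) ∈ C^{α}` for `u ∈ C^{1,α}`" in
semilinear theory.) [folklore] -/
theorem exists_holder_comp (n : ℕ) {γ : ℝ} (hγ0 : 0 < γ) (hγ1 : γ ≤ 1) :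
    ∃ K : ℝ, 1 ≤ K ∧ ∀ {W V' : Type} [NormedAddCommGroup W] [NormedSpace ℝ W]
      [NormedAddCommGroup V'] [NormedSpace ℝ V'] [CompleteSpace V']
      (Φ : E × W → V') (w : E → W) {R A B : ℝ}, 0 ≤ B → ContDiff ℝ (n + 1) Φ →
      (∀ j ≤ n + 1, ∀ (x : E) (a : W), ‖a‖ ≤ R → ‖iteratedFDeriv ℝ j Φ (x, a)‖ ≤ B) →
      (∀ x, ‖w x‖ ≤ R) → IsHolderField n γ A w →
      IsHolderField n γ (K * ((1 + A) * (1 + B)) ^ (2 ^ n)) (fun x => Φ (x, w x)) := by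
  induction n with
  | zero =>
    refine ⟨2, by norm_num, ?_⟩
    intro W V' _ _ _ _ _ Φ w R A B hB hΦ hbd hwR hw
    have hA : 0 ≤ A := hw.nonneg
    have hval : ∀ x, ‖Φ (x, w x)‖ ≤ B := fun x => by
      have := hbd 0 (Nat.zero_le _) x (w x) (hwR x)
      rwa [norm_iteratedFDeriv_zero] at this
    have hAB : 1 ≤ (1 + A) * (1 + B) := by nlinarith
    simp only [pow_zero, pow_one]
    refine ⟨?_, ?_, ?_⟩
    · exact contDiff_zero.2 (hΦ.continuous.comp (continuous_id.prodMk hw.continuous))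
    · intro j hj x
      obtain rfl : j = 0 := Nat.le_zero.1 hj
      rw [norm_iteratedFDeriv_zero]
      calc ‖Φ (x, w x)‖ ≤ B := hval x
        _ ≤ 2 * ((1 + A) * (1 + B)) := by nlinarith
    · intro x y
      rw [iteratedFDeriv_zero_eq_comp, Function.comp_apply, Function.comp_apply, ← map_sub,
        LinearIsometryEquiv.norm_map]
      -- Lipschitz bound on the convex set `E × B̄(0, R)`
      have hdF : ∀ p ∈ (univ : Set E) ×ˢ closedBall (0 : W) R, DifferentiableAt ℝ Φ p :=
        fun p _ => hΦ.differentiable (by norm_num) p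
      have hbdF : ∀ p ∈ (univ : Set E) ×ˢ closedBall (0 : W) R, ‖fderiv ℝ Φ p‖ ≤ B := by
        rintro ⟨x', a⟩ ⟨-, ha⟩
        rw [mem_closedBall_zero_iff] at ha
        have := hbd 1 (by norm_num) x' a ha
        rwa [norm_iteratedFDeriv_one] at this
      have hconv : Convex ℝ ((univ : Set E) ×ˢ closedBall (0 : W) R) :=
        convex_univ.prod (convex_closedBall 0 R)
      have hmx : (x, w x) ∈ (univ : Set E) ×ˢ closedBall (0 : W) R :=
        mk_mem_prod (mem_univ _) (mem_closedBall_zero_iff.2 (hwR x))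
      have hmy : (y, w y) ∈ (univ : Set E) ×ˢ closedBall (0 : W) R :=
        mk_mem_prod (mem_univ _) (mem_closedBall_zero_iff.2 (hwR y))
      have hlip : ‖Φ (x, w x) - Φ (y, w y)‖ ≤ B * ‖(x, w x) - (y, w y)‖ :=
        hconv.norm_image_sub_le_of_norm_fderiv_le hdF hbdF hmy hmx
      have hw0 : ‖w x - w y‖ ≤ A * ‖x - y‖ ^ γ := by
        have := hw.holder x y
        rwa [iteratedFDeriv_zero_eq_comp, Function.comp_apply, Function.comp_apply, ← map_sub,
          LinearIsometryEquiv.norm_map] at this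
      have hpair : ‖(x, w x) - (y, w y)‖ ≤ ‖x - y‖ + A * ‖x - y‖ ^ γ := by
        rw [Prod.mk_sub_mk, Prod.norm_def]
        exact max_le (le_add_of_nonneg_right (by positivity))
          (hw0.trans (le_add_of_nonneg_left (norm_nonneg _)))
      have h2B : ‖Φ (x, w x) - Φ (y, w y)‖ ≤ 2 * B :=
        (norm_sub_le _ _).trans (by linarith [hval x, hval y])
      set r : ℝ := ‖x - y‖ with hr
      have hr0 : 0 ≤ r := norm_nonneg _
      by_cases hr1 : r ≤ 1
      · have hrr : r ≤ r ^ γ := by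
          rcases hr0.eq_or_lt with h | h
          · rw [← h, Real.zero_rpow hγ0.ne']
          · calc r = r ^ (1 : ℝ) := (Real.rpow_one r).symm
              _ ≤ r ^ γ := Real.rpow_le_rpow_of_exponent_ge h hr1 hγ1
        calc ‖Φ (x, w x) - Φ (y, w y)‖ ≤ B * (r + A * r ^ γ) := hlip.trans (by gcongr)
          _ ≤ B * (r ^ γ + A * r ^ γ) := by gcongr
          _ = B * (1 + A) * r ^ γ := by ring
          _ ≤ 2 * ((1 + A) * (1 + B)) * r ^ γ := by
              apply mul_le_mul_of_nonneg_right _ (Real.rpow_nonneg hr0 _)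
              nlinarith
      · push Not at hr1
        have hrγ : 1 ≤ r ^ γ := Real.one_le_rpow hr1.le hγ0.le
        calc ‖Φ (x, w x) - Φ (y, w y)‖ ≤ 2 * B := h2B
          _ ≤ 2 * ((1 + A) * (1 + B)) * 1 := by nlinarith
          _ ≤ 2 * ((1 + A) * (1 + B)) * r ^ γ := by gcongr
  | succ n ih =>
    obtain ⟨K, hK1, hK⟩ := ih
    obtain ⟨KL, hKL0, hLeib⟩ := HolderLeibniz.exists_leibniz_holder (E := E) n
    have h2p : (1 : ℝ) ≤ 2 ^ (2 ^ (n + 1)) := one_le_pow₀ (by norm_num)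
    refine ⟨(1 + KL) * K ^ 2 * 2 ^ (2 ^ (n + 1)), ?_, ?_⟩
    · have hK2 : 1 ≤ K ^ 2 := one_le_pow₀ hK1
      exact one_le_mul_of_one_le_of_one_le (one_le_mul_of_one_le_of_one_le (by linarith) hK2) h2p
    intro W V' _ _ _ _ _ Φ w R A B hB hΦ hbd hwR hw
    have hA : 0 ≤ A := hw.nonneg
    have hval : ∀ x, ‖Φ (x, w x)‖ ≤ B := fun x => by
      have := hbd 0 (Nat.zero_le _) x (w x) (hwR x)
      rwa [norm_iteratedFDeriv_zero] at this
    -- the constant of the pieces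
    set C₁ : ℝ := K * (2 * ((1 + A) * (1 + B))) ^ (2 ^ n) with hC₁
    have hbase : 1 ≤ (1 + A) * (1 + B) := by nlinarith
    have hbase2 : 1 ≤ 2 * ((1 + A) * (1 + B)) := by nlinarith
    have hpow1 : 1 ≤ (2 * ((1 + A) * (1 + B))) ^ (2 ^ n) := one_le_pow₀ hbase2
    have hC₁1 : 1 ≤ C₁ := one_le_mul_of_one_le_of_one_le hK1 hpow1
    have hC₁0 : 0 ≤ C₁ := zero_le_one.trans hC₁1
    have hbaseC₁ : 2 * ((1 + A) * (1 + B)) ≤ C₁ := by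
      calc 2 * ((1 + A) * (1 + B)) ≤ (2 * ((1 + A) * (1 + B))) ^ (2 ^ n) :=
            le_self_pow₀ hbase2 (pow_ne_zero n two_ne_zero)
        _ ≤ C₁ := le_mul_of_one_le_left (zero_le_one.trans hpow1) hK1
    have hAC₁ : A ≤ C₁ := le_trans (by nlinarith) hbaseC₁
    have hBC₁ : B ≤ C₁ := le_trans (by nlinarith) hbaseC₁
    have hIHC₁ : K * ((1 + 2 * A) * (1 + B)) ^ (2 ^ n) ≤ C₁ := by
      have h1 : (1 + 2 * A) * (1 + B) ≤ 2 * ((1 + A) * (1 + B)) := by nlinarith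
      have h2 : ((1 + 2 * A) * (1 + B)) ^ (2 ^ n) ≤ (2 * ((1 + A) * (1 + B))) ^ (2 ^ n) :=
        pow_le_pow_left₀ (by positivity) h1 _
      exact mul_le_mul_of_nonneg_left h2 (zero_le_one.trans hK1)
    -- the partial-derivative operators
    let Λ₁ : (E × W →L[ℝ] V') →L[ℝ] (E →L[ℝ] V') :=
      (ContinuousLinearMap.compL ℝ E (E × W) V').flip (ContinuousLinearMap.inl ℝ E W)
    let Λ₂ : (E × W →L[ℝ] V') →L[ℝ] (W →L[ℝ] V') :=
      (ContinuousLinearMap.compL ℝ W (E × W) V').flip (ContinuousLinearMap.inr ℝ E W)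
    have hΛ₁ : ‖Λ₁‖ ≤ 1 := by
      refine ContinuousLinearMap.opNorm_le_bound _ zero_le_one fun M => ?_
      change ‖M.comp (ContinuousLinearMap.inl ℝ E W)‖ ≤ 1 * ‖M‖
      calc ‖M.comp (ContinuousLinearMap.inl ℝ E W)‖ ≤ ‖M‖ * ‖ContinuousLinearMap.inl ℝ E W‖ :=
            M.opNorm_comp_le _
        _ ≤ ‖M‖ * 1 := by gcongr; exact ContinuousLinearMap.norm_inl_le_one ℝ E W
        _ = 1 * ‖M‖ := by ring
    have hΛ₂ : ‖Λ₂‖ ≤ 1 := by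
      refine ContinuousLinearMap.opNorm_le_bound _ zero_le_one fun M => ?_
      change ‖M.comp (ContinuousLinearMap.inr ℝ E W)‖ ≤ 1 * ‖M‖
      calc ‖M.comp (ContinuousLinearMap.inr ℝ E W)‖ ≤ ‖M‖ * ‖ContinuousLinearMap.inr ℝ E W‖ :=
            M.opNorm_comp_le _
        _ ≤ ‖M‖ * 1 := by gcongr; exact ContinuousLinearMap.norm_inr_le_one ℝ E W
        _ = 1 * ‖M‖ := by ring
    -- `DΦ` is `C^{n+1}` and the partial derivatives inherit the bounds one order up
    have hΦ' : ContDiff ℝ (n + 1) (fderiv ℝ Φ) := hΦ.fderiv_right (by norm_cast)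
    have hpiece : ∀ {X : Type} [NormedAddCommGroup X] [NormedSpace ℝ X]
        (Λ : (E × W →L[ℝ] V') →L[ℝ] X), ‖Λ‖ ≤ 1 →
        ContDiff ℝ (n + 1) (fun p => Λ (fderiv ℝ Φ p)) ∧
        ∀ j ≤ n + 1, ∀ (x : E) (a : W), ‖a‖ ≤ R →
          ‖iteratedFDeriv ℝ j (fun p => Λ (fderiv ℝ Φ p)) (x, a)‖ ≤ B := by
      intro X _ _ Λ hΛ
      refine ⟨Λ.contDiff.comp hΦ', fun j hj x a ha => ?_⟩
      calc ‖iteratedFDeriv ℝ j (fun p => Λ (fderiv ℝ Φ p)) (x, a)‖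
          = ‖iteratedFDeriv ℝ j (Λ ∘ fderiv ℝ Φ) (x, a)‖ := rfl
        _ ≤ ‖Λ‖ * ‖iteratedFDeriv ℝ j (fderiv ℝ Φ) (x, a)‖ :=
            Λ.norm_iteratedFDeriv_comp_left hΦ'.contDiffAt (by exact_mod_cast hj)
        _ ≤ 1 * ‖iteratedFDeriv ℝ (j + 1) Φ (x, a)‖ := by
            rw [norm_iteratedFDeriv_fderiv]; gcongr
        _ ≤ B := by rw [one_mul]; exact hbd (j + 1) (by omega) x a ha
    obtain ⟨hΦ₁c, hΦ₁b⟩ := hpiece Λ₁ hΛ₁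
    obtain ⟨hΦ₂c, hΦ₂b⟩ := hpiece Λ₂ hΛ₂
    -- the pieces of the derivative along the graph
    have hwn : IsHolderField n γ (2 * A) w := hw.of_succ hγ0.le hγ1
    have hP₁ : IsHolderField n γ C₁ (fun x => Λ₁ (fderiv ℝ Φ (x, w x))) :=
      (hK (fun p => Λ₁ (fderiv ℝ Φ p)) w hB hΦ₁c hΦ₁b hwR hwn).mono_const hIHC₁
    have hP₂ : IsHolderField n γ C₁ (fun x => Λ₂ (fderiv ℝ Φ (x, w x))) :=
      (hK (fun p => Λ₂ (fderiv ℝ Φ p)) w hB hΦ₂c hΦ₂b hwR hwn).mono_const hIHC₁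
    have hDw : IsHolderField n γ C₁ (fderiv ℝ w) := hw.fderiv_right.mono_const hAC₁
    -- the product `(∂₂Φ ∘ graph w) ∘ Dw`
    set B₀ : (W →L[ℝ] V') →L[ℝ] (E →L[ℝ] W) →L[ℝ] (E →L[ℝ] V') :=
      ContinuousLinearMap.compL ℝ E W V' with hB₀
    have hB₀1 : ‖B₀‖ ≤ 1 := ContinuousLinearMap.norm_compL_le ℝ E W V'
    obtain ⟨hQb, hQH⟩ := hLeib B₀ hγ0 hγ1 hC₁0 hP₂.contDiff hDw.contDiff hP₂.norm_le hDw.norm_le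
      hP₂.holder hDw.holder
    have hKLC : KL * ‖B₀‖ * C₁ ^ 2 ≤ KL * C₁ ^ 2 := by
      calc KL * ‖B₀‖ * C₁ ^ 2 ≤ KL * 1 * C₁ ^ 2 := by gcongr
        _ = KL * C₁ ^ 2 := by ring
    have hQ : IsHolderField n γ (KL * C₁ ^ 2)
        (fun x => B₀ (Λ₂ (fderiv ℝ Φ (x, w x))) (fderiv ℝ w x)) := by
      refine ⟨B₀.isBoundedBilinearMap.contDiff.comp (hP₂.contDiff.prodMk hDw.contDiff),
        fun j hj x => (hQb j hj x).trans hKLC, fun x y => (hQH x y).trans ?_⟩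
      exact mul_le_mul_of_nonneg_right hKLC (Real.rpow_nonneg (norm_nonneg _) _)
    have hS : IsHolderField n γ (C₁ + KL * C₁ ^ 2)
        ((fun x => Λ₁ (fderiv ℝ Φ (x, w x))) + fun x => B₀ (Λ₂ (fderiv ℝ Φ (x, w x))) (fderiv ℝ w x)) :=
      hP₁.add hQ
    -- the derivative of the composite
    have key : ∀ (M : E × W →L[ℝ] V') (T : E →L[ℝ] W),
        M.comp ((ContinuousLinearMap.id ℝ E).prod T) = Λ₁ M + B₀ (Λ₂ M) T := by
      intro M T
      ext v
      have hv : M (v, T v) = M (v, 0) + M (0, T v) := by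
        rw [← map_add, Prod.mk_add_mk, add_zero, zero_add]
      simpa [hB₀, Λ₁, Λ₂] using hv
    have hwd : Differentiable ℝ w := hw.contDiff.differentiable (by norm_cast)
    have hGd : ∀ x, HasFDerivAt (fun x => Φ (x, w x))
        (Λ₁ (fderiv ℝ Φ (x, w x)) + B₀ (Λ₂ (fderiv ℝ Φ (x, w x))) (fderiv ℝ w x)) x := by
      intro x
      have h1 : HasFDerivAt (fun y => (y, w y)) ((ContinuousLinearMap.id ℝ E).prod (fderiv ℝ w x)) x :=
        (hasFDerivAt_id x).prodMk (hwd x).hasFDerivAt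
      have h2 : HasFDerivAt Φ (fderiv ℝ Φ (x, w x)) (x, w x) :=
        (hΦ.differentiable (by norm_cast) _).hasFDerivAt
      exact (h2.comp x h1).congr_fderiv (key _ _)
    have hGfd : fderiv ℝ (fun x => Φ (x, w x)) =
        ((fun x => Λ₁ (fderiv ℝ Φ (x, w x))) + fun x => B₀ (Λ₂ (fderiv ℝ Φ (x, w x))) (fderiv ℝ w x)) :=
      funext fun x => (hGd x).fderiv
    have hGdiff : Differentiable ℝ (fun x => Φ (x, w x)) := fun x => (hGd x).differentiableAt
    have hS' : IsHolderField n γ (C₁ + KL * C₁ ^ 2) (fderiv ℝ fun x => Φ (x, w x)) := by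
      rw [hGfd]; exact hS
    have h0 : ∀ x, ‖Φ (x, w x)‖ ≤ C₁ + KL * C₁ ^ 2 := fun x =>
      (hval x).trans (hBC₁.trans (le_add_of_nonneg_right (by positivity)))
    have hG : IsHolderField (n + 1) γ (C₁ + KL * C₁ ^ 2) (fun x => Φ (x, w x)) :=
      IsHolderField.of_fderiv_right hGdiff hS' h0
    refine hG.mono_const ?_
    -- `C₁ + KL C₁² ≤ (1 + KL) C₁² = (1 + KL) K² 2^{2^{n+1}} ((1 + A)(1 + B))^{2^{n+1}}`
    have hsq : C₁ ≤ C₁ ^ 2 := by nlinarith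
    have hC₁sq : C₁ ^ 2 = K ^ 2 * 2 ^ (2 ^ (n + 1)) * ((1 + A) * (1 + B)) ^ (2 ^ (n + 1)) := by
      rw [hC₁, mul_pow, ← pow_mul, ← pow_succ, mul_pow]
      ring
    calc C₁ + KL * C₁ ^ 2 ≤ C₁ ^ 2 + KL * C₁ ^ 2 := by gcongr
      _ = (1 + KL) * C₁ ^ 2 := by ring
      _ = (1 + KL) * K ^ 2 * 2 ^ (2 ^ (n + 1)) * ((1 + A) * (1 + B)) ^ (2 ^ (n + 1)) := by
          rw [hC₁sq]; ring

end HolderComp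

/-! ### The Laplacian commutes with iterated derivatives -/

section LaplacianComm

-- nested operator types
set_option maxSynthPendingDepth 3

variable {E : Type*} [NormedAddCommGroup E] [InnerProductSpace ℝ E] [FiniteDimensional ℝ E]
variable {F : Type*} [NormedAddCommGroup F] [NormedSpace ℝ F]

omit [FiniteDimensional ℝ E] in
/-- Schwarz for `C²` maps with values in a normed space: `∂_b∂_a v = ∂_a∂_b v`
(Mathlib `ContDiffAt.isSymmSndFDerivAt`). [folklore] -/
theorem fderiv_fderiv_apply_comm {v : E → F} (hv : ContDiff ℝ 2 v) (x a b : E) :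
    fderiv ℝ (fun y => fderiv ℝ v y a) x b = fderiv ℝ (fun y => fderiv ℝ v y b) x a := by
  have hd : DifferentiableAt ℝ (fderiv ℝ v) x :=
    ((hv.fderiv_right (m := 1) le_rfl).differentiable one_ne_zero) x
  rw [fderiv_clm_apply hd (differentiableAt_const a), fderiv_clm_apply hd (differentiableAt_const b)]
  simp only [fderiv_fun_const, Pi.zero_apply, ContinuousLinearMap.comp_zero, zero_add,
    ContinuousLinearMap.flip_apply]
  have h22 : minSmoothness ℝ 2 ≤ (2 : WithTop ℕ∞) := by
    rw [minSmoothness_of_isRCLikeNormedField]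
  exact hv.contDiffAt.isSymmSndFDerivAt h22 b a

/-- **`∂_a Δ G = Δ ∂_a G`** for `G ∈ C³` with values in a normed space (Schwarz twice; the tree's
`FluidPDE.fderiv_laplacian_apply_of_contDiff_three` is the case `E = ℝ³`). [folklore] -/
theorem fderiv_laplacian_apply {G : E → F} (hG : ContDiff ℝ 3 G) (x a : E) :
    fderiv ℝ (Δ G) x a = (Δ fun y => fderiv ℝ G y a) x := by
  set b := stdOrthonormalBasis ℝ E with hb
  have hG2 : ContDiff ℝ 2 G := hG.of_le (by norm_num)
  have hDi : ∀ w : E, ContDiff ℝ 2 (fun y => fderiv ℝ G y w) := fun w =>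
    (hG.fderiv_right (m := 2) (by norm_num)).clm_apply contDiff_const
  have hDii : ∀ w : E, ContDiff ℝ 1 (fun y => fderiv ℝ (fun z => fderiv ℝ G z w) y w) := fun w =>
    ((hDi w).fderiv_right (m := 1) (by norm_num)).clm_apply contDiff_const
  have hΔ : Δ G = fun y => ∑ i, fderiv ℝ (fun z => fderiv ℝ G z (b i)) y (b i) :=
    funext fun y => laplacian_eq_sum_fderiv_fderiv_normed b hG2 y
  rw [hΔ, fderiv_fun_sum fun i _ => ((hDii (b i)).differentiable one_ne_zero x),
    _root_.sum_apply, laplacian_eq_sum_fderiv_fderiv_normed b (hDi a) x]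
  refine Finset.sum_congr rfl fun i _ => ?_
  rw [fderiv_fderiv_apply_comm (hDi (b i)) x (b i) a]
  have hin : (fun y => fderiv ℝ (fun z => fderiv ℝ G z (b i)) y a) =
      fun y => fderiv ℝ (fun z => fderiv ℝ G z a) y (b i) :=
    funext fun y => fderiv_fderiv_apply_comm hG2 y (b i) a
  rw [hin]

/-- **`D(ΔG) = Δ(DG)`** as `(E →L F)`-valued functions, for `G ∈ C³` (the Laplacian of the
operator-valued field `DG` evaluated at `a` is `Δ(∂_a G)`, `ContDiffAt.laplacian_CLM_comp_left`).
[folklore] -/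
theorem fderiv_laplacian {G : E → F} (hG : ContDiff ℝ 3 G) : fderiv ℝ (Δ G) = Δ (fderiv ℝ G) := by
  funext x
  ext a
  rw [fderiv_laplacian_apply hG x a]
  have h2 : ContDiff ℝ 2 (fderiv ℝ G) := hG.fderiv_right (by norm_num)
  have h := (h2.contDiffAt (x := x)).laplacian_CLM_comp_left (l := ContinuousLinearMap.apply ℝ F a)
  simp only [Function.comp_apply, ContinuousLinearMap.apply_apply] at h
  rw [← h]
  rfl

/-- **Iterated derivatives commute with the Laplacian**: `D^k(Δf) = Δ(D^k f)` for `f ∈ C^{k+2}`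
(induction on `k`: `D^{k+1} = curry⁻¹ ∘ D(D^k)`, the previous lemma for the `C³` field `D^k f`, and
`Δ` commutes with the currying isometry). [folklore] -/
theorem iteratedFDeriv_laplacian {f : E → F} {k : ℕ} (hf : ContDiff ℝ (k + 2) f) :
    iteratedFDeriv ℝ k (Δ f) = Δ (iteratedFDeriv ℝ k f) := by
  induction k with
  | zero =>
    rw [iteratedFDeriv_zero_eq_comp, iteratedFDeriv_zero_eq_comp]
    have h := InnerProductSpace.laplacian_CLE_comp_left (f := f)
      (l := (continuousMultilinearCurryFin0 ℝ E F).symm.toContinuousLinearEquiv)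
    simpa using h.symm
  | succ k ih =>
    have hf' : ContDiff ℝ (k + 2) f := hf.of_le (by norm_cast; omega)
    have hk3 : ContDiff ℝ 3 (iteratedFDeriv ℝ k f) := hf.iteratedFDeriv_right (by norm_cast; omega)
    rw [iteratedFDeriv_succ_eq_comp_left, iteratedFDeriv_succ_eq_comp_left, ih hf',
      fderiv_laplacian hk3]
    have h := InnerProductSpace.laplacian_CLE_comp_left (f := fderiv ℝ (iteratedFDeriv ℝ k f))
      (l := (continuousMultilinearCurryLeftEquiv ℝ (fun _ : Fin (k + 1) => E) F).symm.toContinuousLinearEquiv)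
    simpa using h.symm

/-- Pointwise form: `D^k(Δf)(x) = Δ(D^k f)(x)` for `f ∈ C^{k+2}`. [folklore] -/
theorem iteratedFDeriv_laplacian_apply {f : E → F} {k : ℕ} (hf : ContDiff ℝ (k + 2) f) (x : E) :
    iteratedFDeriv ℝ k (Δ f) x = Δ (iteratedFDeriv ℝ k f) x := by
  rw [iteratedFDeriv_laplacian hf]

end LaplacianComm

end SemilinearHeat

end Literature.Analysis.PDE
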